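import Summits.NavierStokesRegularity.FluidComputer.SymmetryPlaneFluxRate
import Literature.Analysis.FluidPDE.VectorCalculusProofs
import HarnessLib

/-!
# Plane flux law for the normal vorticity — GENERAL form (no symmetry): through a FIXED plane
# region the normal-vorticity content of ANY classical Navier–Stokes / Euler flow changes
# inviscidly only across the region's rim, by exactly two channels

HONEST FRAMING (cell `ns-blowup`, lane W «gathering number», seat `ns-blowup-wind` g5; human
ruling D-0035). WHAT THIS IS NOT: not a statement about Navier–Stokes blow-up in either direction
and not about any particular flow: the classical vorticity equation in conservation form on a
coordinate plane, integrated over a fixed plane rectangle — kernel-checked because it COMPLETES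
the exact half of the lane-W record. The companion files `SymmetryPlaneFluxLaw.lean`,
`SymmetryPlaneVorticityBudget.lean`, `SymmetryPlaneFluxRate.lean` (seat g4) prove the law ON A
MIRROR PLANE of a mirror-symmetric flow (vorticity normal to the plane, plane materially
invariant); their synthesis memo records what they do NOT say: «nothing for configurations
WITHOUT the mirror symmetry (there … material transport through [the plane] is allowed)»
(HOME/wind/LANE-W-SYNTHESIS.md §3). This file removes the symmetry hypothesis and names the
extra channel. For ANY classical solution of the Navier–Stokes system on `ℝ³ × S`, ANY real `ν`
(Euler: `ν = 0`), any force `f` (tree predicate `IsClassicalNSSolutionOn S ν f u p`; `S` of unique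
differentiability, `S ⊆ closure (interior S)`), every direction `i`, every `t ∈ S`:
* §1 (kinematics) for `u, ω` differentiable at `x` and divergence free there, transport minus
  stretching is a PLANAR divergence of the antisymmetric flux `Jⱼ = uⱼωᵢ − uᵢωⱼ`:
  `(Dω[u] − Du[ω])ᵢ = ∑_{j ≠ i} ∂ⱼ(uⱼ ωᵢ − uᵢ ωⱼ)` (`transport_sub_stretch_apply_eq_sum_sub`; the
  component form of `(u·∇)ω − (ω·∇)u = curl (ω × u)`); for `ω = curl u`, `u ∈ C²` solenoidal, at
  EVERY point (`transport_sub_stretch_curl_eq_sum_sub`, via the tree's `divergence_curl_eq_zero_holds`).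
* §2 (Green) over a rectangle `R = P([a,b])` of the affine plane `{xᵢ = (x₀)ᵢ}`, chart
  `P (s,t) = x₀ + s e_{i+1} + t e_{i+2}`: `∫_R (D(curl u)[u] − Du[curl u])ᵢ = ∮_{∂R} J · n_out`
  (`setIntegral_transport_sub_stretch_curl_eq_edges`; four signed edge integrals).
* §3 (dynamics) `plane_vorticity_eq`: at EVERY point
  `∂ₜωᵢ = ν ∑ⱼ∂ⱼ∂ⱼωᵢ − ∑_{j≠i} ∂ⱼ(uⱼωᵢ − uᵢωⱼ) + (curl f)ᵢ`, `ω = curl u` (the tree's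
  `IsClassicalNSSolutionOn.vorticity_transport_forced` + incompressibility + §1), and over a FIXED
  plane rectangle `setIntegral_plane_vorticity_eq`:
  `∫_R ∂ₜωᵢ = ν∫_R ∑ⱼ∂ⱼ∂ⱼωᵢ − ∮_{∂R} ωᵢ (u_∥·n_out) + ∮_{∂R} uᵢ (ω_∥·n_out) + ∫_R (curl f)ᵢ`.
Read for the cell: apart from viscosity and the force, the normal flux through a fixed plane
region of ANY smooth incompressible flow changes only across the region's RIM, by exactly two
channels — (1) in-plane advection of normal vorticity (the only channel on a mirror plane) and
(2) transport by the NORMAL velocity of in-plane vorticity threading the rim (vortex lines lying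
across the rim lifted through the plane: the «material crossing» channel that RESULT P-WIND-3
instrumented with its CROSSING COUNT — a MODEL datum; nothing here depends on it). On a mirror
plane `uᵢ = 0 = ω_∥`, channel (2) vanishes and §3 is `SymmetryPlaneFluxLaw.mirrorPlane_vorticity_eq`.
The `d/dt` form is in the companion `PlaneVorticityFluxRate.lean`. All proved; 0 `sorry`; no
definitions, no named facts; nothing on the budget of a FIXED plane region existed in the tree
(`lean search 'plane|flux|Kelvin'`). References (classical): Majda–Bertozzi, *Vorticity and
Incompressible Flow*, CUP 2002, §1.4 (1.32)–(1.33), §1.6; Saffman, *Vortex Dynamics*, §1.5–1.6. -/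

noncomputable section

open MeasureTheory Set Function Filter Topology
open scoped BigOperators

namespace Summit.NavierStokesRegularity.FluidComputer.PlaneVorticityFluxLaw

open Literature.Analysis.FluidPDE Summit.NavierStokesRegularity.FluidComputer.SymmetryPlaneFluxLaw

/-! ### §1 The pointwise law: transport minus stretching is a planar divergence, everywhere -/

section Pointwise

variable {u ω : EuclideanSpace ℝ (Fin 3) → EuclideanSpace ℝ (Fin 3)} {x : EuclideanSpace ℝ (Fin 3)}

/-- **Pointwise plane flux law (abstract form, no symmetry).** For fields `u, ω` differentiable
at `x` and both divergence free there (`∑ⱼ ∂ⱼuⱼ (x) = 0 = ∑ⱼ ∂ⱼωⱼ (x)`), the `i`-th component of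
the vorticity-equation nonlinearity `Dω(x)[u(x)] − Du(x)[ω(x)]` (transport minus stretching) is
the PLANAR divergence (directions `j ≠ i` only) of the antisymmetric flux `Jⱼ = uⱼ ωᵢ − uᵢ ωⱼ`:
`(Dω[u] − Du[ω])ᵢ = ∑_{j ≠ i} ∂ⱼ (uⱼ ωᵢ − uᵢ ωⱼ)` (the `j = i` term vanishes identically; the
component form of `(u·∇)ω − (ω·∇)u = curl (ω × u)` for solenoidal `u, ω`). Product rule and the
two divergence constraints. -/
theorem transport_sub_stretch_apply_eq_sum_sub (i : Fin 3)
    (hu : DifferentiableAt ℝ u x) (hω : DifferentiableAt ℝ ω x)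
    (hdivu : ∑ j, pderiv j (fun y => u y j) x = 0)
    (hdivω : ∑ j, pderiv j (fun y => ω y j) x = 0) :
    fderiv ℝ ω x (u x) i - fderiv ℝ u x (ω x) i =
      ∑ j ∈ Finset.univ.erase i, pderiv j (fun y => u y j * ω y i - u y i * ω y j) x := by
  have hu' : ∀ j, DifferentiableAt ℝ (fun y => u y j) x := fun j =>
    (EuclideanSpace.proj j : EuclideanSpace ℝ (Fin 3) →L[ℝ] ℝ).differentiableAt.comp x hu
  have hω' : ∀ j, DifferentiableAt ℝ (fun y => ω y j) x := fun j =>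
    (EuclideanSpace.proj j : EuclideanSpace ℝ (Fin 3) →L[ℝ] ℝ).differentiableAt.comp x hω
  have hprod : ∀ j, pderiv j (fun y => u y j * ω y i - u y i * ω y j) x =
      (u x j * pderiv j (fun y => ω y i) x + ω x i * pderiv j (fun y => u y j) x) -
        (u x i * pderiv j (fun y => ω y j) x + ω x j * pderiv j (fun y => u y i) x) := by
    intro j
    rw [pderiv_apply, fderiv_fun_sub ((hu' j).fun_mul (hω' i)) ((hu' i).fun_mul (hω' j)),
      fderiv_fun_mul (hu' j) (hω' i), fderiv_fun_mul (hu' i) (hω' j)]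
    simp only [sub_apply, add_apply, smul_apply, smul_eq_mul, pderiv_apply]
  have h1 : fderiv ℝ ω x (u x) i = ∑ j, u x j * pderiv j (fun y => ω y i) x := by
    rw [euclidean_fderiv_apply_comp hω, fderiv_apply_eq_sum_mul_pderiv]
  have h2 : fderiv ℝ u x (ω x) i = ∑ j, ω x j * pderiv j (fun y => u y i) x := by
    rw [euclidean_fderiv_apply_comp hu, fderiv_apply_eq_sum_mul_pderiv]
  rw [h1, h2, sum_univ_fin_three_rot _ i, sum_univ_fin_three_rot _ i, sum_univ_erase_fin_three,
    hprod, hprod]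
  rw [sum_univ_fin_three_rot _ i] at hdivu hdivω
  linear_combination (u x i) * hdivω - (ω x i) * hdivu

/-- **Pointwise plane flux law for the vorticity of a divergence-free `C²` field**, at EVERY
point (no symmetry, no plane condition): for `u ∈ C²(ℝ³; ℝ³)` with `∑ⱼ ∂ⱼuⱼ = 0`,
`(D(curl u)[u] − Du[curl u])ᵢ = ∑_{j ≠ i} ∂ⱼ (uⱼ (curl u)ᵢ − uᵢ (curl u)ⱼ)`
(`div curl u = 0` by the tree's `divergence_curl_eq_zero_holds`, symmetry of second derivatives). -/
theorem transport_sub_stretch_curl_eq_sum_sub (i : Fin 3) (hC : ContDiff ℝ 2 u)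
    (hdiv : ∀ x, ∑ j, pderiv j (fun y => u y j) x = 0) (x : EuclideanSpace ℝ (Fin 3)) :
    fderiv ℝ (curl u) x (u x) i - fderiv ℝ u x (curl u x) i =
      ∑ j ∈ Finset.univ.erase i, pderiv j (fun y => u y j * curl u y i - u y i * curl u y j) x := by
  have hd : Differentiable ℝ u := hC.differentiable (by norm_num)
  have hC' : ContDiff ℝ ((1 : ℕ∞) + 1) u := hC.of_le (by norm_num)
  have hcd : Differentiable ℝ (curl u) := (contDiff_curl hC').differentiable one_ne_zero
  have hdivω : ∑ j, pderiv j (fun y => curl u y j) x = 0 := by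
    rw [← divergence_eq_sum_pderiv (hcd x)]
    exact divergence_curl_eq_zero_holds u hC x
  exact transport_sub_stretch_apply_eq_sum_sub i (hd x) (hcd x) (hdiv x) hdivω

end Pointwise

/-! ### §2 Green's formula on a rectangle of the affine plane `{xᵢ = cᵢ}` for a planar divergence -/

section Integrated

variable {u : EuclideanSpace ℝ (Fin 3) → EuclideanSpace ℝ (Fin 3)}

/-- The affine chart has the constant derivative `L = fst • e_{i+1} + snd • e_{i+2}`. -/
theorem hasFDerivAt_planeChartAt (i : Fin 3) {x₀ : EuclideanSpace ℝ (Fin 3)}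
    {P : ℝ × ℝ → EuclideanSpace ℝ (Fin 3)}
    (hP : ∀ q, P q = x₀ + (q.1 • (stdVec (i + 1) : EuclideanSpace ℝ (Fin 3)) + q.2 • stdVec (i + 2)))
    (q : ℝ × ℝ) :
    HasFDerivAt P
      ((ContinuousLinearMap.fst ℝ ℝ ℝ).smulRight (stdVec (i + 1) : EuclideanSpace ℝ (Fin 3)) +
        (ContinuousLinearMap.snd ℝ ℝ ℝ).smulRight (stdVec (i + 2) : EuclideanSpace ℝ (Fin 3))) q := by
  have hPe : P = fun q => x₀ + ((ContinuousLinearMap.fst ℝ ℝ ℝ).smulRight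
      (stdVec (i + 1) : EuclideanSpace ℝ (Fin 3)) +
        (ContinuousLinearMap.snd ℝ ℝ ℝ).smulRight (stdVec (i + 2) : EuclideanSpace ℝ (Fin 3))) q := by
    funext q; rw [hP]; simp
  rw [hPe]
  exact (ContinuousLinearMap.hasFDerivAt _).const_add x₀

/-- The affine chart is continuous. -/
theorem continuous_planeChartAt (i : Fin 3) {x₀ : EuclideanSpace ℝ (Fin 3)}
    {P : ℝ × ℝ → EuclideanSpace ℝ (Fin 3)}
    (hP : ∀ q, P q = x₀ + (q.1 • (stdVec (i + 1) : EuclideanSpace ℝ (Fin 3)) + q.2 • stdVec (i + 2))) :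
    Continuous P := by
  have : P = fun q => x₀ + (q.1 • (stdVec (i + 1) : EuclideanSpace ℝ (Fin 3)) + q.2 • stdVec (i + 2)) :=
    funext hP
  rw [this]; fun_prop

/-- **Green's formula for a planar divergence on a rectangle of the affine plane** through `x₀`
normal to `eᵢ`: for `C¹` scalar fields `A, B` on `ℝ³` and the chart
`P (s,t) = x₀ + s e_{i+1} + t e_{i+2}`,
`∫_{[a,b]} (∂_{i+1} A + ∂_{i+2} B) ∘ P = [∫ B ∘ P (s, ·) ds]_{t=a₂}^{t=b₂} + [∫ A ∘ P (·, t) dt]_{s=a₁}^{s=b₁}`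
— Mathlib's divergence theorem on the rectangle
(`integral_divergence_prod_Icc_of_hasFDerivAt_of_le`) pulled back along the chart. -/
theorem setIntegral_pderiv_add_pderiv_eq_edges (i : Fin 3) {A B : EuclideanSpace ℝ (Fin 3) → ℝ}
    (hA : ContDiff ℝ 1 A) (hB : ContDiff ℝ 1 B)
    {x₀ : EuclideanSpace ℝ (Fin 3)} {P : ℝ × ℝ → EuclideanSpace ℝ (Fin 3)}
    (hP : ∀ q, P q = x₀ + (q.1 • (stdVec (i + 1) : EuclideanSpace ℝ (Fin 3)) + q.2 • stdVec (i + 2)))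
    {a b : ℝ × ℝ} (hab : a ≤ b) :
    ∫ q in Icc a b, (pderiv (i + 1) A (P q) + pderiv (i + 2) B (P q)) =
      (((∫ s in a.1..b.1, B (P (s, b.2))) - ∫ s in a.1..b.1, B (P (s, a.2))) +
        ∫ t in a.2..b.2, A (P (b.1, t))) - ∫ t in a.2..b.2, A (P (a.1, t)) := by
  have hAd : Differentiable ℝ A := hA.differentiable one_ne_zero
  have hBd : Differentiable ℝ B := hB.differentiable one_ne_zero
  have hPc : Continuous P := continuous_planeChartAt i hP
  set L : ℝ × ℝ →L[ℝ] EuclideanSpace ℝ (Fin 3) :=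
    (ContinuousLinearMap.fst ℝ ℝ ℝ).smulRight (stdVec (i + 1) : EuclideanSpace ℝ (Fin 3)) +
      (ContinuousLinearMap.snd ℝ ℝ ℝ).smulRight (stdVec (i + 2) : EuclideanSpace ℝ (Fin 3)) with hLdef
  have hL10 : L (1, 0) = stdVec (i + 1) := by simp [hLdef]
  have hL01 : L (0, 1) = stdVec (i + 2) := by simp [hLdef]
  have hdA : ∀ q, HasFDerivAt (A ∘ P) ((fderiv ℝ A (P q)).comp L) q :=
    fun q => (hAd (P q)).hasFDerivAt.comp q (hasFDerivAt_planeChartAt i hP q)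
  have hdB : ∀ q, HasFDerivAt (B ∘ P) ((fderiv ℝ B (P q)).comp L) q :=
    fun q => (hBd (P q)).hasFDerivAt.comp q (hasFDerivAt_planeChartAt i hP q)
  have hdiv_eq : ∀ q, (fderiv ℝ A (P q)).comp L (1, 0) + (fderiv ℝ B (P q)).comp L (0, 1) =
      pderiv (i + 1) A (P q) + pderiv (i + 2) B (P q) := by
    intro q
    rw [ContinuousLinearMap.comp_apply, ContinuousLinearMap.comp_apply, hL10, hL01]
    rfl
  have hcont : Continuous fun q : ℝ × ℝ =>
      (fderiv ℝ A (P q)).comp L (1, 0) + (fderiv ℝ B (P q)).comp L (0, 1) := by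
    have hcA : Continuous fun y => fderiv ℝ A y := hA.continuous_fderiv one_ne_zero
    have hcB : Continuous fun y => fderiv ℝ B y := hB.continuous_fderiv one_ne_zero
    simp only [ContinuousLinearMap.comp_apply]
    exact ((hcA.comp hPc).clm_apply continuous_const).add ((hcB.comp hPc).clm_apply continuous_const)
  have key := integral_divergence_prod_Icc_of_hasFDerivAt_of_le (A ∘ P) (B ∘ P)
    (fun q => (fderiv ℝ A (P q)).comp L) (fun q => (fderiv ℝ B (P q)).comp L) a b hab
    ((hAd.continuous.comp hPc).continuousOn) ((hBd.continuous.comp hPc).continuousOn)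
    (fun q _ => hdA q) (fun q _ => hdB q) (hcont.continuousOn.integrableOn_compact isCompact_Icc)
  simp only [hdiv_eq] at key
  rw [key]
  rfl

/-- **Green's formula for the normal-vorticity flux `J = ω ᵢu_∥ − uᵢ ω_∥` on a plane rectangle.**
For `u, ω ∈ C¹(ℝ³; ℝ³)` and the affine chart `P (s,t) = x₀ + s e_{i+1} + t e_{i+2}`,
`∫_{P([a,b])} ∑_{j≠i} ∂ⱼ(uⱼωᵢ − uᵢωⱼ) = ∮_{∂R} (ωᵢ u_∥ − uᵢ ω_∥) · n_out`, the right side being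
`[∫ (u_{i+2}ωᵢ − uᵢω_{i+2}) ds]_{t=a₂}^{t=b₂} + [∫ (u_{i+1}ωᵢ − uᵢω_{i+1}) dt]_{s=a₁}^{s=b₁}`. -/
theorem setIntegral_sum_pderiv_flux_eq_edges (i : Fin 3)
    {u ω : EuclideanSpace ℝ (Fin 3) → EuclideanSpace ℝ (Fin 3)}
    (hu : ContDiff ℝ 1 u) (hω : ContDiff ℝ 1 ω)
    {x₀ : EuclideanSpace ℝ (Fin 3)} {P : ℝ × ℝ → EuclideanSpace ℝ (Fin 3)}
    (hP : ∀ q, P q = x₀ + (q.1 • (stdVec (i + 1) : EuclideanSpace ℝ (Fin 3)) + q.2 • stdVec (i + 2)))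
    {a b : ℝ × ℝ} (hab : a ≤ b) :
    ∫ q in Icc a b, ∑ j ∈ Finset.univ.erase i, pderiv j (fun y => u y j * ω y i - u y i * ω y j) (P q) =
      (((∫ s in a.1..b.1, (u (P (s, b.2)) (i + 2) * ω (P (s, b.2)) i - u (P (s, b.2)) i * ω (P (s, b.2)) (i + 2))) -
          ∫ s in a.1..b.1, (u (P (s, a.2)) (i + 2) * ω (P (s, a.2)) i - u (P (s, a.2)) i * ω (P (s, a.2)) (i + 2))) +
        ∫ t in a.2..b.2, (u (P (b.1, t)) (i + 1) * ω (P (b.1, t)) i - u (P (b.1, t)) i * ω (P (b.1, t)) (i + 1))) -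
      ∫ t in a.2..b.2, (u (P (a.1, t)) (i + 1) * ω (P (a.1, t)) i - u (P (a.1, t)) i * ω (P (a.1, t)) (i + 1)) := by
  have huC : ∀ j, ContDiff ℝ 1 fun y => u y j := fun j => contDiff_euclidean.1 hu j
  have hωC : ∀ j, ContDiff ℝ 1 fun y => ω y j := fun j => contDiff_euclidean.1 hω j
  have hA : ContDiff ℝ 1 fun y => u y (i + 1) * ω y i - u y i * ω y (i + 1) :=
    ((huC (i + 1)).mul (hωC i)).sub ((huC i).mul (hωC (i + 1)))
  have hB : ContDiff ℝ 1 fun y => u y (i + 2) * ω y i - u y i * ω y (i + 2) :=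
    ((huC (i + 2)).mul (hωC i)).sub ((huC i).mul (hωC (i + 2)))
  simp only [sum_univ_erase_fin_three]
  exact setIntegral_pderiv_add_pderiv_eq_edges i hA hB hP hab

/-- **Integrated plane flux law for the vorticity of a divergence-free `C²` field (no symmetry).**
For `u ∈ C²(ℝ³; ℝ³)` with `∑ⱼ ∂ⱼuⱼ = 0`, over every rectangle `R = P([a,b])` of ANY affine plane
`{xᵢ = cᵢ}` (chart `P (s,t) = x₀ + s e_{i+1} + t e_{i+2}`):
`∫_R (D(curl u)[u] − Du[curl u])ᵢ = ∮_{∂R} (ωᵢ u_∥ − uᵢ ω_∥) · n_out`, `ω = curl u`.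
Read along `∂ₜω = −(Dω[u] − Du[ω]) + νΔω + curl f`: the INVISCID rate of change of the normal-vorticity
content of a fixed plane region is a pure RIM integral — in-plane advection of normal vorticity
(`ωᵢ u_∥ · n`) plus normal-velocity transport of rim-threading vorticity (`−uᵢ ω_∥ · n`). -/
theorem setIntegral_transport_sub_stretch_curl_eq_edges (i : Fin 3) (hC : ContDiff ℝ 2 u)
    (hdiv : ∀ x, ∑ j, pderiv j (fun y => u y j) x = 0)
    {x₀ : EuclideanSpace ℝ (Fin 3)} {P : ℝ × ℝ → EuclideanSpace ℝ (Fin 3)}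
    (hP : ∀ q, P q = x₀ + (q.1 • (stdVec (i + 1) : EuclideanSpace ℝ (Fin 3)) + q.2 • stdVec (i + 2)))
    {a b : ℝ × ℝ} (hab : a ≤ b) :
    ∫ q in Icc a b, (fderiv ℝ (curl u) (P q) (u (P q)) i - fderiv ℝ u (P q) (curl u (P q)) i) =
      (((∫ s in a.1..b.1, (u (P (s, b.2)) (i + 2) * curl u (P (s, b.2)) i -
            u (P (s, b.2)) i * curl u (P (s, b.2)) (i + 2))) -
          ∫ s in a.1..b.1, (u (P (s, a.2)) (i + 2) * curl u (P (s, a.2)) i -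
            u (P (s, a.2)) i * curl u (P (s, a.2)) (i + 2))) +
        ∫ t in a.2..b.2, (u (P (b.1, t)) (i + 1) * curl u (P (b.1, t)) i -
          u (P (b.1, t)) i * curl u (P (b.1, t)) (i + 1))) -
      ∫ t in a.2..b.2, (u (P (a.1, t)) (i + 1) * curl u (P (a.1, t)) i -
        u (P (a.1, t)) i * curl u (P (a.1, t)) (i + 1)) := by
  have hC1 : ContDiff ℝ 1 u := hC.of_le (by norm_num)
  have hC' : ContDiff ℝ ((1 : ℕ∞) + 1) u := hC.of_le (by norm_num)
  have hcurl : ContDiff ℝ 1 (curl u) := by exact_mod_cast contDiff_curl hC'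
  rw [← setIntegral_sum_pderiv_flux_eq_edges i hC1 hcurl hP hab]
  exact setIntegral_congr_fun measurableSet_Icc fun q _ =>
    transport_sub_stretch_curl_eq_sum_sub i hC hdiv (P q)

end Integrated

/-! ### §3 Classical Navier–Stokes / Euler solutions: the law at every point, over every fixed
plane rectangle, and in `d/dt` form -/

section Solutions

open scoped ContDiff

variable {S : Set ℝ} {ν : ℝ} {f u : ℝ → EuclideanSpace ℝ (Fin 3) → EuclideanSpace ℝ (Fin 3)}
  {p : ℝ → EuclideanSpace ℝ (Fin 3) → ℝ}

/-- **The normal vorticity obeys a planar conservation law at EVERY point of EVERY classical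
Navier–Stokes / Euler flow (viscous and force sources).** Let `(u, p)` be a classical solution of
the Navier–Stokes system with viscosity `ν` (any real `ν`; `ν = 0` is Euler) and force `f` on
`ℝ³ × S`, `S` a time set of unique differentiability contained in the closure of its interior.
Then for every direction `i`, every `t ∈ S` and EVERY point `x`:
`∂ₜ ωᵢ = ν ∑ⱼ ∂ⱼ∂ⱼ ωᵢ − ∑_{j ≠ i} ∂ⱼ (uⱼ ωᵢ − uᵢ ωⱼ) + (curl f)ᵢ`, `ω = curl u`
— the `i`-th component of `∂ₜω + curl (ω × u) = νΔω + curl f`; no symmetry, no plane condition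
(the «crossing» part `−uᵢ ω_∥` of the flux vanishes on a mirror plane, `uᵢ = 0 = ω_∥`, recovering
`SymmetryPlaneFluxLaw.mirrorPlane_vorticity_eq`). Proof: the tree's
`IsClassicalNSSolutionOn.vorticity_transport_forced` (empty word, `Ω_{i+1,i+2} = ωᵢ`),
incompressibility, and §1. -/
theorem plane_vorticity_eq (h : IsClassicalNSSolutionOn S ν f u p) (hS : UniqueDiffOn ℝ S)
    (hcl : S ⊆ closure (interior S)) {t : ℝ} (ht : t ∈ S) (x : EuclideanSpace ℝ (Fin 3))
    (i : Fin 3) :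
    Literature.Analysis.FluidPDE.timeDerivWithin S (fun s y => curl (u s) y i) t x =
      ν * ∑ j, pderiv j (pderiv j fun y => curl (u t) y i) x -
        ∑ j ∈ Finset.univ.erase i,
          pderiv j (fun y => u t y j * curl (u t) y i - u t y i * curl (u t) y j) x +
        curl (f t) x i := by
  have e11 : i + 1 + 1 = i + 2 := by fin_cases i <;> rfl
  have e12 : i + 1 + 2 = i := by fin_cases i <;> rfl
  have e21 : i + 2 + 1 = i := by fin_cases i <;> rfl
  have e22 : i + 2 + 2 = i + 1 := by fin_cases i <;> rfl
  have hu : ∀ {s}, s ∈ S → ContDiff ℝ ∞ (u s) := fun hs => h.contDiff_velocity hs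
  have hut : ContDiff ℝ ∞ (u t) := hu ht
  have hud : Differentiable ℝ (u t) := hut.differentiable (by simp)
  have hC2 : ContDiff ℝ 2 (u t) := hut.of_le (by norm_cast)
  have hU : ∀ j, ContDiff ℝ ∞ fun y => u t y j := fun j => h.contDiff_comp ht j
  have hUd : ∀ j, Differentiable ℝ fun y => u t y j := fun j => (hU j).differentiable (by simp)
  have hdU : ∀ j m, ContDiff ℝ ∞ (pderiv m fun y => u t y j) := fun j m => contDiff_pderiv (hU j) m
  have hdUd : ∀ j m, Differentiable ℝ (pderiv m fun y => u t y j) := fun j m =>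
    (hdU j m).differentiable (by simp)
  have hdiv : ∀ y, ∑ j, pderiv j (fun z => u t z j) y = 0 := fun y => h.sum_pderiv_comp_eq_zero ht y
  -- §1 at `x`: the planar divergence is transport minus stretching
  have hpt := transport_sub_stretch_curl_eq_sum_sub i hC2 hdiv x
  have hcd : Differentiable ℝ (curl (u t)) :=
    (contDiff_curl (n := (⊤ : ℕ∞)) (hut.of_le (by simp))).differentiable (by simp)
  have hD : fderiv ℝ (curl (u t)) x (u t x) i = ∑ j, u t x j * pderiv j (fun y => curl (u t) y i) x := by
    rw [euclidean_fderiv_apply_comp (hcd x), fderiv_apply_eq_sum_mul_pderiv]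
  have hSt : fderiv ℝ (u t) x (curl (u t) x) i = ∑ j, curl (u t) x j * pderiv j (fun y => u t y i) x := by
    rw [euclidean_fderiv_apply_comp (hud x), fderiv_apply_eq_sum_mul_pderiv]
  -- `ω = Ω` : curl components as differences of partials, at `x` and as functions
  have hcv : ∀ s ∈ S, ∀ y, curl (u s) y i = vortComp (u s) (i + 1) (i + 2) y := fun s hs y =>
    curl_apply_eq_vortComp (((hu hs).differentiable (by simp)) y) i
  have hwi : curl (u t) x i =
      pderiv (i + 1) (fun y => u t y (i + 2)) x - pderiv (i + 2) (fun y => u t y (i + 1)) x :=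
    hcv t ht x
  have hwk : curl (u t) x (i + 1) =
      pderiv (i + 2) (fun y => u t y i) x - pderiv i (fun y => u t y (i + 2)) x := by
    rw [curl_apply_eq_vortComp (hud x) (i + 1), e11, e12]; rfl
  have hwl : curl (u t) x (i + 2) =
      pderiv i (fun y => u t y (i + 1)) x - pderiv (i + 1) (fun y => u t y i) x := by
    rw [curl_apply_eq_vortComp (hud x) (i + 2), e21, e22]; rfl
  have hF : curl (f t) x i = vortComp (f t) (i + 1) (i + 2) x :=
    curl_apply_eq_vortComp (((h.contDiff_force hS ht).differentiable (by simp)) x) i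
  have hT : Literature.Analysis.FluidPDE.timeDerivWithin S (fun s y => curl (u s) y i) t x =
      Literature.Analysis.FluidPDE.timeDerivWithin S
        (fun s y => vortComp (u s) (i + 1) (i + 2) y) t x :=
    timeDerivWithin_congr_on hcv ht x
  -- product rule for the Leibniz remainders of the tree identity
  have hexp : ∀ a j b, pderiv a (fun y => u t y j * pderiv j (fun z => u t z b) y) x =
      pderiv a (fun y => u t y j) x * pderiv j (fun z => u t z b) x +
        u t x j * pderiv a (pderiv j fun z => u t z b) x := by
    intro a j b
    rw [pderiv_mul (hUd j) (hdUd b j)]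
  -- the tree's vorticity transport identity with the empty word, component `Ω_{i+1,i+2}`
  have hv := h.vorticity_transport_forced hS hcl ht x (Fin.elim0 : Fin 0 → Fin 3) (i + 1) (i + 2)
  simp only [ipderiv_zero, ipderiv_cons, hexp] at hv
  rw [sum_univ_fin_three_rot _ i, sum_univ_fin_three_rot _ i, sum_univ_fin_three_rot _ i] at hv
  rw [hT, hF, ← hpt, hD, hSt, sum_univ_fin_three_rot _ i, sum_univ_fin_three_rot _ i,
    sum_univ_fin_three_rot _ i, hwi, hwk, hwl]
  simp only [hcv t ht]
  have hdivx := hdiv x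
  rw [sum_univ_fin_three_rot _ i] at hdivx
  linear_combination hv - (pderiv (i + 1) (fun y => u t y (i + 2)) x -
    pderiv (i + 2) (fun y => u t y (i + 1)) x) * hdivx

/-- **The flux law for the normal vorticity of a FIXED plane rectangle (rate form, no symmetry).**
In the setting of `plane_vorticity_eq`, integrate over the rectangle `R = P([a₁,b₁] × [a₂,b₂])`
of the affine plane through `x₀` normal to `eᵢ` (chart `P (s,t) = x₀ + s e_{i+1} + t e_{i+2}`):
`∫_R ∂ₜωᵢ = ν ∫_R ∑ⱼ∂ⱼ∂ⱼ ωᵢ − ∮_{∂R} (ωᵢ u_∥ − uᵢ ω_∥) · n_out + ∫_R (curl f)ᵢ`,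
the rim term being
`[∫ (u_{i+2}ωᵢ − uᵢω_{i+2}) ds]_{t=a₂}^{t=b₂} + [∫ (u_{i+1}ωᵢ − uᵢω_{i+1}) dt]_{s=a₁}^{s=b₁}`
(Green's formula of §2): apart from viscosity and the force, the normal-vorticity content of a
FIXED plane region of ANY classical flow changes only across its rim, by (1) in-plane advection of
normal vorticity `ωᵢ u_∥ · n` and (2) normal-velocity transport of rim-threading vorticity
`−uᵢ ω_∥ · n` — channel (2) is what a mirror symmetry switches off
(`SymmetryPlaneFluxLaw.setIntegral_mirrorPlane_vorticity_eq`). -/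
theorem setIntegral_plane_vorticity_eq (h : IsClassicalNSSolutionOn S ν f u p)
    (hS : UniqueDiffOn ℝ S) (hcl : S ⊆ closure (interior S)) {t : ℝ} (ht : t ∈ S) (i : Fin 3)
    {x₀ : EuclideanSpace ℝ (Fin 3)} {P : ℝ × ℝ → EuclideanSpace ℝ (Fin 3)}
    (hP : ∀ q, P q = x₀ + (q.1 • (stdVec (i + 1) : EuclideanSpace ℝ (Fin 3)) + q.2 • stdVec (i + 2)))
    {a b : ℝ × ℝ} (hab : a ≤ b) :
    ∫ q in Icc a b, Literature.Analysis.FluidPDE.timeDerivWithin S (fun s y => curl (u s) y i) t (P q) =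
      ν * (∫ q in Icc a b, ∑ j, pderiv j (pderiv j fun y => curl (u t) y i) (P q)) -
        ((((∫ s in a.1..b.1, (u t (P (s, b.2)) (i + 2) * curl (u t) (P (s, b.2)) i -
              u t (P (s, b.2)) i * curl (u t) (P (s, b.2)) (i + 2))) -
            ∫ s in a.1..b.1, (u t (P (s, a.2)) (i + 2) * curl (u t) (P (s, a.2)) i -
              u t (P (s, a.2)) i * curl (u t) (P (s, a.2)) (i + 2))) +
          ∫ r in a.2..b.2, (u t (P (b.1, r)) (i + 1) * curl (u t) (P (b.1, r)) i -
            u t (P (b.1, r)) i * curl (u t) (P (b.1, r)) (i + 1))) -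
        ∫ r in a.2..b.2, (u t (P (a.1, r)) (i + 1) * curl (u t) (P (a.1, r)) i -
          u t (P (a.1, r)) i * curl (u t) (P (a.1, r)) (i + 1))) +
      ∫ q in Icc a b, curl (f t) (P q) i := by
  have hut : ContDiff ℝ ∞ (u t) := h.contDiff_velocity ht
  have hu1 : ContDiff ℝ 1 (u t) := hut.of_le (by exact_mod_cast le_top)
  have hcurlI : ContDiff ℝ ∞ (curl (u t)) := contDiff_curl (n := (⊤ : ℕ∞)) (hut.of_le (by simp))
  have hcurl1 : ContDiff ℝ 1 (curl (u t)) := hcurlI.of_le (by exact_mod_cast le_top)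
  have hΩ : ∀ j, ContDiff ℝ ∞ fun y => curl (u t) y j := fun j => contDiff_euclidean.1 hcurlI j
  have hPc : Continuous P := continuous_planeChartAt i hP
  -- continuity (hence integrability on the compact rectangle) of the three pieces
  have hLc : Continuous fun q : ℝ × ℝ => ∑ j, pderiv j (pderiv j fun y => curl (u t) y i) (P q) := by
    refine continuous_finsetSum _ fun j _ => ?_
    exact ((contDiff_pderiv (contDiff_pderiv (hΩ i) j) j).continuous).comp hPc
  have hDc : Continuous fun q : ℝ × ℝ => ∑ j ∈ Finset.univ.erase i,
      pderiv j (fun y => u t y j * curl (u t) y i - u t y i * curl (u t) y j) (P q) := by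
    refine continuous_finsetSum _ fun j _ => ?_
    exact (contDiff_pderiv (((h.contDiff_comp ht j).mul (hΩ i)).sub
      ((h.contDiff_comp ht i).mul (hΩ j))) j).continuous.comp hPc
  have hFc : Continuous fun q : ℝ × ℝ => curl (f t) (P q) i := by
    have hcf : Continuous (curl (f t)) :=
      continuous_curl ((h.contDiff_force hS ht).of_le (by exact_mod_cast le_top))
    have : (fun q : ℝ × ℝ => curl (f t) (P q) i) =
        (EuclideanSpace.proj i : EuclideanSpace ℝ (Fin 3) →L[ℝ] ℝ) ∘ curl (f t) ∘ P := rfl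
    rw [this]
    exact (EuclideanSpace.proj i).continuous.comp (hcf.comp hPc)
  have hLi : IntegrableOn (fun q : ℝ × ℝ => ν * ∑ j, pderiv j (pderiv j fun y => curl (u t) y i) (P q))
      (Icc a b) := (continuous_const.mul hLc).continuousOn.integrableOn_compact isCompact_Icc
  have hDi : IntegrableOn (fun q : ℝ × ℝ => ∑ j ∈ Finset.univ.erase i,
      pderiv j (fun y => u t y j * curl (u t) y i - u t y i * curl (u t) y j) (P q)) (Icc a b) :=
    hDc.continuousOn.integrableOn_compact isCompact_Icc
  have hFi : IntegrableOn (fun q : ℝ × ℝ => curl (f t) (P q) i) (Icc a b) :=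
    hFc.continuousOn.integrableOn_compact isCompact_Icc
  have hLDi : Integrable (fun q : ℝ × ℝ =>
      ν * ∑ j, pderiv j (pderiv j fun y => curl (u t) y i) (P q) -
        ∑ j ∈ Finset.univ.erase i,
          pderiv j (fun y => u t y j * curl (u t) y i - u t y i * curl (u t) y j) (P q))
      (volume.restrict (Icc a b)) := hLi.sub hDi
  -- the pointwise law, integrated, and Green's formula for the rim term
  rw [setIntegral_congr_fun measurableSet_Icc (fun q _ => plane_vorticity_eq h hS hcl ht (P q) i),
    integral_add hLDi hFi, integral_sub hLi hDi, integral_const_mul,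
    setIntegral_sum_pderiv_flux_eq_edges i hu1 hcurl1 hP hab]

end Solutions

end Summit.NavierStokesRegularity.FluidComputer.PlaneVorticityFluxLaw
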